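import Summits.QuantumFields.YangMills.Theorems.UV3ACBounds5UpperRows
import Summits.QuantumFields.YangMills.Theorems.AlphaInputsT3ACv3Pint
import Summits.QuantumFields.YangMills.Theorems.AlphaInputsT3ACEnvelope
import Summits.QuantumFields.YangMills.Theorems.UV3UnitPartitionLowerOfPackage
import Literature.MathematicalPhysics.QuantumFieldTheory.Balaban1983to89.T3HeightwiseDensityBounds
import Literature.MathematicalPhysics.QuantumFieldTheory.Balaban1983to89.T3CruxEstimates
import HarnessLib

/-!
# UP∘-QUOT (A) — SAME-LEVEL ANCHORING: the two halves of [Balaban1985UV3] Thm 2 at ONE level of the pinned `ℰp` tower give TWO-SIDED bounds of the NORMALISED density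
# `Z_K⁻¹ρ_{K−n}` with the counterterm anchor `exp(−(E_{K−n} − E))` CANCELLED — over the v3 (α) record `AlphaInputsT3AC.PkgAtV3`, rows as explicit hypotheses

Cell `ym3-torus` (YM ladder rung R3 = continuum `SU(2)` Yang–Mills on the three-torus — a RUNG, NOT d = 4, NOT infinite volume, NOT a mass gap, NOT Clay).  Width seat
`ym-ust-20520-w3` (gen 19, LEAD-20520 by lineage); `--supports stmt-QuantumFields-20520 --as helper`, count-neutral, definition-free, default heartbeats.  Companion (B) =
`…HeightwiseQuotientOfPackageV3` (the package knit: UP∘ ∕ LOWB∘ of the persistence organ).  LEAD split with ym3-torus-px8 g15's (O-UP) (★★OWNER WORD 102): px8 = lit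
`Bounds5UpperAtHeight F γ E` in Bałaban's normalisation (needs the counterterm size (62)–(65)); this pair = the QUOTIENT letters the organ reads, (62)–(65)-FREE.

THE POINT.  At level `j` of run `K` both printed halves carry the SAME factor `exp(−(E_j − E))` (`E_j − E = −Σ_{i<j}E^{(i)}`, (62)∕(64)): (41) `ρ_j ≤ e^{−(E_j−E)+Rm_j}·Σ_h wtP_j(h)·
e^{−mainT+Pint+Zterm}` (✓`PkgAtV3.resDensity_le_sum_ae`: PINNED windowed weights, `dV`-a.e.) and (47) `e^{−(E_j−E)−Rm_j}·χ_j·e^{−mainT(triv)+Pint(triv)} ≤ ρ_j` (✓`PkgAtV3.le_resDensity_ae`).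
Mass preservation `∫ρ_j dV_j = Z_K` (✓`integral_emlDensity_eq_partitionFn`) turns the integrated (47) into a lower bound of `Z_K` with the same anchor, so `Z_K⁻¹ρ_j` is bounded on both
sides by anchor-free constants (§1).  The remaining inputs are explicit hypotheses here (discharged in (B)): the (46) bound `CP`, `exp(Rm_j) ≤ CRu`, the (41) large-field history-sum bound
`B` a.e. (ym3-torus-px8 g15 ✓`UV3ACLargeFieldEnvelopeAtLevel.lfSum_le_exp_ae_of_massEnvelope`), the trivial-history main-term bound `M` on print's window ([Balaban1985Variational] Thm 1).
* §1 ★ `mul_measureReal_le_integral_of_lower`, ★ `ae_inv_integral_mul_le_of_halves`, ★ `ae_le_inv_integral_mul_of_halves` — generic measure theory: the anchor cancels.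
* §2 (`p : PkgAtV3 F 𝔠 γ hγ hγ1 K`, level `j ≤ K`) `wtP_nonneg`; ★★ `ae_resDensity_le_anchor` (upper half, anchor kept); `chi_eq_one_of_plaqSmall` (`χ_j = 1` on `{PlaqSmall θBal(K − j)}`,
  ✓`PkgAtV3.eps1_eq`); ★★ `ae_anchor_le_resDensity` (lower half on the window, anchor kept); the (46) level bound is ym3-torus-px8 g15's ✓`UV3ACBounds5UpperRows.abs_Pint_le_level`
  (imported, not restated).
* §3 `measureReal_window_level_eq` (`dV^{(K)}_{K−n}{PlaqSmall δ} = dU^{(n)}{PlaqSmall δ}`: `fieldShift` measure-preserving, lit `T3CruxEstimates.plaqSmall_fieldShift`), `θBal_pos_of_window`,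
  ★★★ `ae_quotient_bounds_level` — a.e. `Z_K⁻¹ρ^{univ}_{K−n} ≤ (CRu·e^{CP}·B)∕(CRu⁻¹·e^{−M−CP}·vol_n)` and, on the window, `(CRu⁻¹e^{−M−CP})∕(CRu·e^{CP}·B) ≤ Z_K⁻¹ρ^{univ}_{K−n}`.

HONEST SCOPE.  Bookkeeping; every analytic input is a displayed hypothesis or a landed row of the v3 package (OPEN hypothesis schema); nothing of Theorem 1, UP∘, PERS₁∘, 20520 or the
rung is proved here; rung R3 = SU(2) YM₃ on T³ — NOT d = 4, NOT infinite volume, NOT a mass gap, NOT Clay.  Sorry-free, axioms standard.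

References: T. Bałaban, CMP **102** (1985) 255–275 [Balaban1985UV3] ((1)–(7) pp.256–257, (41)+(43) p.266, (46)–(47) p.267, (62) p.271, (64) p.273, pp.273–274); T. Bałaban,
CMP **102** (1985) 277–309 [Balaban1985Variational] (Thm 1 p.279); T. Bałaban, CMP **109** (1987) 249–301 [Balaban1987RG1] ((0.1)–(0.4) pp.251–253).
-/

set_option autoImplicit false

noncomputable section

namespace Summit.QuantumFields.YangMills.Theorems.FluctuationComparisonRegPrIntLHeightwiseQuotientAnchoring

open MeasureTheory
open scoped BigOperators
open Literature.MathematicalPhysics.QuantumFieldTheory.Balaban1983to89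
open Literature.MathematicalPhysics.QuantumFieldTheory.Balaban1983to89.T3ContinuumYM3Torus
open Literature.MathematicalPhysics.QuantumFieldTheory.Balaban1983to89.T3UnitLawDensityEML (ℰp emlDensity)
open Literature.MathematicalPhysics.QuantumFieldTheory.Balaban1983to89.T3UnitScaleTilt (θBal measurableSet_plaqSmall)
open Literature.MathematicalPhysics.QuantumFieldTheory.Balaban1983to89.T3RestrictedUnitDensity (resDensity resDensity_nonneg integrable_resDensity)
open Literature.MathematicalPhysics.QuantumFieldTheory.Balaban1983to89.T3TiltDescent (heightDensity)
open Literature.MathematicalPhysics.QuantumFieldTheory.Balaban1983to89.T3HeightwiseDensityBounds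
open Literature.MathematicalPhysics.QuantumFieldTheory.Balaban1983to89.T3AlphaInputsAC (RmSize exp_two_Rm_le Rm_nonneg)
open Literature.MathematicalPhysics.QuantumFieldTheory.Balaban1983to89.T3LevelShift (fieldShift measurePreserving_fieldShift)
open Literature.MathematicalPhysics.QuantumFieldTheory.Balaban1983to89.Missing (partitionFn partitionFn_pos' isProbabilityMeasure_fieldMeasure)
open Literature.MathematicalPhysics.QuantumFieldTheory.Balaban1985CMP102
open Literature.MathematicalPhysics.QuantumFieldTheory.Balaban1985CMP102.Setting
open Summit.QuantumFields.Balaban3D.Carriers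
open Summit.QuantumFields.Balaban3D.Proofs.Primitives
open Summit.QuantumFields.Balaban3D.Proofs.InputsAC

/-! ## §1 Generic: two same-level halves give two-sided bounds of the normalised density — the anchor cancels -/

/-- ★ **THE LOWER HALF INTEGRATED**: `0 ≤ ρ` integrable with `e·ℓ ≤ ρ` a.e. on a measurable `S` gives `e·ℓ·μ(S) ≤ ∫ρ`. [cite: Balaban1985UV3, (6) p.257] -/
theorem mul_measureReal_le_integral_of_lower {X : Type*} [MeasurableSpace X] {μ : Measure X} [IsFiniteMeasure μ] {ρ : X → ℝ}
    (hρ : Integrable ρ μ) (hρ0 : ∀ x, 0 ≤ ρ x) {S : Set X} (hS : MeasurableSet S) {e ℓ : ℝ}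
    (hlow : ∀ᵐ x ∂μ, x ∈ S → e * ℓ ≤ ρ x) :
    e * ℓ * μ.real S ≤ ∫ y, ρ y ∂μ := by
  have h1 : ∫ y in S, (e * ℓ) ∂μ ≤ ∫ y in S, ρ y ∂μ :=
    setIntegral_mono_on_ae (integrable_const _).integrableOn hρ.integrableOn hS
      (by filter_upwards [hlow] with x hx hxS using hx hxS)
  have h2 : ∫ y in S, ρ y ∂μ ≤ ∫ y, ρ y ∂μ :=
    setIntegral_le_integral hρ (Filter.Eventually.of_forall hρ0)
  have h0 : ∫ y in S, (e * ℓ) ∂μ = e * ℓ * μ.real S := by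
    rw [setIntegral_const, smul_eq_mul, mul_comm]
  linarith

/-- ★ **SAME-LEVEL ANCHORING, UPPER (generic measure theory)**: on a probability space, IF `0 ≤ ρ` is integrable with `ρ ≤ e·U` a.e. and `e·ℓ ≤ ρ` a.e. on a
measurable set `S` of positive measure, `e, ℓ > 0`, THEN `(∫ρ)⁻¹·ρ ≤ U ∕ (ℓ·μ(S))` a.e. — the common factor `e` (for us Bałaban's `exp(E − E_j)`) CANCELS; no size
information on `e` is used. [cite: Balaban1985UV3, (5)–(6) pp.256–257] -/
theorem ae_inv_integral_mul_le_of_halves {X : Type*} [MeasurableSpace X] {μ : Measure X} [IsProbabilityMeasure μ] {ρ : X → ℝ}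
    (hρ : Integrable ρ μ) (hρ0 : ∀ x, 0 ≤ ρ x) {S : Set X} (hS : MeasurableSet S) (hμS : 0 < μ.real S) {e U ℓ : ℝ} (he : 0 < e)
    (hℓ : 0 < ℓ) (hup : ∀ᵐ x ∂μ, ρ x ≤ e * U) (hlow : ∀ᵐ x ∂μ, x ∈ S → e * ℓ ≤ ρ x) :
    ∀ᵐ x ∂μ, (∫ y, ρ y ∂μ)⁻¹ * ρ x ≤ U / (ℓ * μ.real S) := by
  have hint := mul_measureReal_le_integral_of_lower hρ hρ0 hS hlow
  have hpos : 0 < e * ℓ * μ.real S := by positivity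
  have hZ : 0 < ∫ y, ρ y ∂μ := lt_of_lt_of_le hpos hint
  filter_upwards [hup] with x hx
  calc (∫ y, ρ y ∂μ)⁻¹ * ρ x ≤ (e * ℓ * μ.real S)⁻¹ * (e * U) :=
        mul_le_mul (by rwa [inv_le_inv₀ hZ hpos]) hx (hρ0 x) (inv_nonneg.mpr hpos.le)
    _ = U / (ℓ * μ.real S) := by field_simp

/-- ★ **SAME-LEVEL ANCHORING, LOWER ON THE WINDOW**: under the same two halves (`U > 0`), `ℓ ∕ U ≤ (∫ρ)⁻¹·ρ` a.e. on `S` (`∫ρ ≤ e·U` on a probability space).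
[cite: Balaban1985UV3, (5)–(6) pp.256–257] -/
theorem ae_le_inv_integral_mul_of_halves {X : Type*} [MeasurableSpace X] {μ : Measure X} [IsProbabilityMeasure μ] {ρ : X → ℝ}
    (hρ : Integrable ρ μ) (hρ0 : ∀ x, 0 ≤ ρ x) {S : Set X} (hS : MeasurableSet S) (hμS : 0 < μ.real S) {e U ℓ : ℝ} (he : 0 < e)
    (hU : 0 < U) (hℓ : 0 < ℓ) (hup : ∀ᵐ x ∂μ, ρ x ≤ e * U) (hlow : ∀ᵐ x ∂μ, x ∈ S → e * ℓ ≤ ρ x) :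
    ∀ᵐ x ∂μ, x ∈ S → ℓ / U ≤ (∫ y, ρ y ∂μ)⁻¹ * ρ x := by
  have hint := mul_measureReal_le_integral_of_lower hρ hρ0 hS hlow
  have hpos : 0 < e * ℓ * μ.real S := by positivity
  have hZ : 0 < ∫ y, ρ y ∂μ := lt_of_lt_of_le hpos hint
  have hZle : ∫ y, ρ y ∂μ ≤ e * U := by
    have h1 : ∫ y, ρ y ∂μ ≤ ∫ _y, e * U ∂μ := integral_mono_ae hρ (integrable_const _) hup
    rwa [integral_const, probReal_univ, one_smul] at h1
  have heU : 0 < e * U := by positivity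
  filter_upwards [hlow] with x hx hxS
  calc ℓ / U = (e * U)⁻¹ * (e * ℓ) := by field_simp
    _ ≤ (∫ y, ρ y ∂μ)⁻¹ * ρ x :=
        mul_le_mul (by rwa [inv_le_inv₀ heU hZ]) (hx hxS) (by positivity) (inv_nonneg.mpr hZ.le)

/-! ## §2 The two halves at level `j` of run `K` for the v3 record's tower, `dV_j`-a.e., with the level anchor `exp(−(E_j − E))` KEPT -/

section Halves

variable {F : T3Family} {𝔠 : AlphaConsts F.L (suGroupModel 2).N} {γ : ℝ} {hγ : 0 < γ} {hγ1 : γ ≤ (min 𝔠.gamma0 1) ^ 2} {K : ℕ}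
  (p : AlphaInputsT3AC.PkgAtV3 F 𝔠 γ hγ hγ1 K)

/-- `0 ≤ wtP` for the record's windowed pinned weights (`PinnedStep.wtP_nonneg_le`). [cite: Balaban1985UV3, (40)–(41) p.266] -/
theorem wtP_nonneg (j : ℕ) (r : Hist (F.P K) j) (W : GaugeField (F.P K) j (Matrix.specialUnitaryGroup (Fin 2) ℂ)) :
    0 ≤ p.wtP j r W :=
  (PinnedStep.wtP_nonneg_le 𝔠.lane p.X (AlphaInputsT3AC.admWindowT3 F 𝔠 γ hγ hγ1 K) j r W).1

/-- ★★ **UPPER HALF AT LEVEL `j`, ANCHOR KEPT**: IF at level `j ≤ K` the interaction sums are bounded above (`Pint_j(r, W) ≤ CP`, every history — (46)), the remainder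
is bounded (`exp(Rm_j) ≤ CRu`) and the (41) LARGE-FIELD HISTORY SUM WITH THE PINNED WEIGHTS is essentially bounded (`Σ_r wtP_j(r,W)·e^{−mainT_j(r,W) + Zterm_j(r)} ≤ B`
a.e. — ✓`UV3ACLargeFieldEnvelopeAtLevel.lfSum_le_exp_ae_of_massEnvelope` of ym3-torus-px8, from the v3 package alone), THEN a.e.
`resDensity F γ K univ j W ≤ exp(−(E_j − E))·(CRu·exp(CP)·B)` — (41)′ with the windowed pinned weights (✓`PkgAtV3.resDensity_le_sum_ae`), `Pint` pulled out of the sum by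
`wtP ≥ 0`. [cite: Balaban1985UV3, (41) p.266 + (46) p.267 + pp.273–274] -/
theorem ae_resDensity_le_anchor (j : ℕ) (hj : j ≤ K) {CP CRu B : ℝ}
    (hP : ∀ (r : Hist (F.P K) j) (W : GaugeField (F.P K) j (Matrix.specialUnitaryGroup (Fin 2) ℂ)), p.T.Pint j r W ≤ CP)
    (hRm : Real.exp (p.T.Rm j) ≤ CRu)
    (hB : ∀ᵐ W ∂fieldMeasure (F.P K) j (Matrix.specialUnitaryGroup (Fin 2) ℂ),
      ∑ r : Hist (F.P K) j, p.wtP j r W * Real.exp (-(p.T.mainT j r W) + p.T.Zterm j r) ≤ B) :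
    ∀ᵐ W ∂fieldMeasure (F.P K) j (Matrix.specialUnitaryGroup (Fin 2) ℂ),
      resDensity F γ K Set.univ j W ≤ Real.exp (-(p.T.Ecst j - p.E)) * (CRu * Real.exp CP * B) := by
  filter_upwards [p.resDensity_le_sum_ae j hj, hB] with W h41 hBW
  -- the sum with `Pint` is at most `e^{CP}` times the sum without
  have hsum : ∑ r : Hist (F.P K) j, p.wtP j r W * Real.exp (-(p.T.mainT j r W) + p.T.Pint j r W + p.T.Zterm j r) ≤
      Real.exp CP * ∑ r : Hist (F.P K) j, p.wtP j r W * Real.exp (-(p.T.mainT j r W) + p.T.Zterm j r) := by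
    rw [Finset.mul_sum]
    refine Finset.sum_le_sum fun r _ => ?_
    have hw := wtP_nonneg p j r W
    have hexp : Real.exp (-(p.T.mainT j r W) + p.T.Pint j r W + p.T.Zterm j r) ≤
        Real.exp CP * Real.exp (-(p.T.mainT j r W) + p.T.Zterm j r) := by
      rw [← Real.exp_add]
      exact Real.exp_le_exp.mpr (by linarith [hP r W])
    calc p.wtP j r W * Real.exp (-(p.T.mainT j r W) + p.T.Pint j r W + p.T.Zterm j r)
        ≤ p.wtP j r W * (Real.exp CP * Real.exp (-(p.T.mainT j r W) + p.T.Zterm j r)) := mul_le_mul_of_nonneg_left hexp hw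
      _ = Real.exp CP * (p.wtP j r W * Real.exp (-(p.T.mainT j r W) + p.T.Zterm j r)) := by ring
  have hB0 : 0 ≤ B := le_trans (Finset.sum_nonneg fun r _ => mul_nonneg (wtP_nonneg p j r W) (Real.exp_nonneg _)) hBW
  have hsplit : Real.exp (-(p.T.Ecst j - p.E) + p.T.Rm j) = Real.exp (-(p.T.Ecst j - p.E)) * Real.exp (p.T.Rm j) := Real.exp_add _ _
  calc resDensity F γ K Set.univ j W
      ≤ Real.exp (-(p.T.Ecst j - p.E) + p.T.Rm j) *
          ∑ r : Hist (F.P K) j, p.wtP j r W * Real.exp (-(p.T.mainT j r W) + p.T.Pint j r W + p.T.Zterm j r) := h41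
    _ ≤ Real.exp (-(p.T.Ecst j - p.E) + p.T.Rm j) * (Real.exp CP * B) :=
        mul_le_mul_of_nonneg_left (hsum.trans (mul_le_mul_of_nonneg_left hBW (Real.exp_nonneg _))) (Real.exp_nonneg _)
    _ = Real.exp (-(p.T.Ecst j - p.E)) * (Real.exp (p.T.Rm j) * Real.exp CP * B) := by rw [hsplit]; ring
    _ ≤ Real.exp (-(p.T.Ecst j - p.E)) * (CRu * Real.exp CP * B) :=
        mul_le_mul_of_nonneg_left (mul_le_mul_of_nonneg_right (mul_le_mul_of_nonneg_right hRm (Real.exp_nonneg _)) hB0)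
          (Real.exp_nonneg _)

/-- **THE TOWER'S `χ_j` IS `1` ON PRINT'S WINDOW `{PlaqSmall θBal(K − j)}`** ((47) p.267; ✓`PkgAtV3.eps1_eq`: `ε₁(j) = θBal(K − j)`). [cite: Balaban1985UV3, (47) p.267 + (7) p.257] -/
theorem chi_eq_one_of_plaqSmall (j : ℕ) (hj : j ≤ K) (W : GaugeField (F.P K) j (Matrix.specialUnitaryGroup (Fin 2) ℂ))
    (hW : PlaqSmall (θBal F.L γ 𝔠.b₀ 𝔠.p₀ (K - j)) W) : p.T.χ j W = 1 := by
  have hε := p.eps1_eq j hj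
  change chiSmall Set.univ ((inputOfAC 𝔠.lane p.X p.𝔖).ε₁ j) W = 1
  rw [hε]
  unfold chiSmall
  rw [if_pos]
  exact fun q _ => hW q

/-- ★★ **LOWER HALF AT LEVEL `j` ON PRINT'S WINDOW, ANCHOR KEPT**: IF at level `j ≤ K` the trivial-history main term is bounded on the window (`mainT_j(triv, W) ≤ M` for
`PlaqSmall θBal(K − j) W` — [Balaban1985Variational] Thm 1 regularity, the EX lane), the trivial-history interaction sum is bounded below (`−CP ≤ Pint_j(triv, W)` — (46))
and `exp(Rm_j) ≤ CRu`, THEN a.e. on the window `exp(−(E_j − E))·(CRu⁻¹·exp(−M − CP)) ≤ resDensity F γ K univ j W` — (47)′ (✓`PkgAtV3.le_resDensity_ae`) with `χ_j = 1`.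
[cite: Balaban1985UV3, (47) p.267; Balaban1985Variational, Thm 1 p.279] -/
theorem ae_anchor_le_resDensity (j : ℕ) (hj : j ≤ K) {CP CRu M : ℝ}
    (hPl : ∀ (W : GaugeField (F.P K) j (Matrix.specialUnitaryGroup (Fin 2) ℂ)), -CP ≤ p.T.Pint j (p.T.triv j) W)
    (hRm : Real.exp (p.T.Rm j) ≤ CRu)
    (hM : ∀ (W : GaugeField (F.P K) j (Matrix.specialUnitaryGroup (Fin 2) ℂ)), PlaqSmall (θBal F.L γ 𝔠.b₀ 𝔠.p₀ (K - j)) W →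
      p.T.mainT j (p.T.triv j) W ≤ M) :
    ∀ᵐ W ∂fieldMeasure (F.P K) j (Matrix.specialUnitaryGroup (Fin 2) ℂ),
      W ∈ {W | PlaqSmall (θBal F.L γ 𝔠.b₀ 𝔠.p₀ (K - j)) W} →
        Real.exp (-(p.T.Ecst j - p.E)) * (CRu⁻¹ * Real.exp (-M - CP)) ≤ resDensity F γ K Set.univ j W := by
  filter_upwards [p.le_resDensity_ae j hj] with W h47 hWS
  have hsmall : PlaqSmall (θBal F.L γ 𝔠.b₀ 𝔠.p₀ (K - j)) W := hWS
  have h47' : Real.exp (-(p.T.Ecst j - p.E) - p.T.Rm j) *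
      (p.T.χ j W * Real.exp (-(p.T.mainT j (p.T.triv j) W) + p.T.Pint j (p.T.triv j) W)) ≤ resDensity F γ K Set.univ j W := h47
  clear h47
  have h47 := h47'
  rw [chi_eq_one_of_plaqSmall p j hj W hsmall, one_mul] at h47
  refine le_trans ?_ h47
  have hsplit : Real.exp (-(p.T.Ecst j - p.E) - p.T.Rm j) = Real.exp (-(p.T.Ecst j - p.E)) * Real.exp (-(p.T.Rm j)) := by
    rw [← Real.exp_add]; ring_nf
  rw [hsplit, mul_assoc]
  refine mul_le_mul_of_nonneg_left ?_ (Real.exp_nonneg _)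
  have h1 : CRu⁻¹ ≤ Real.exp (-(p.T.Rm j)) := by
    rw [Real.exp_neg]
    exact inv_anti₀ (Real.exp_pos _) hRm
  have h2 : Real.exp (-M - CP) ≤ Real.exp (-(p.T.mainT j (p.T.triv j) W) + p.T.Pint j (p.T.triv j) W) :=
    Real.exp_le_exp.mpr (by linarith [hM W hsmall, hPl W])
  exact mul_le_mul h1 h2 (Real.exp_nonneg _) (Real.exp_nonneg _)

end Halves


/-! ## §3 At height `n`: the window volume and the level counts are `K`-free; the two-sided quotient bounds at level `K − n` -/

section Height

variable (F : T3Family) {n K : ℕ}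

/-- **THE WINDOW VOLUME AT LEVEL `K − n` IS THE HEIGHT-`n` VOLUME** (hence `K`-free): `dV^{(K)}_{K−n}{PlaqSmall δ} = dU^{(n)}_0{PlaqSmall δ}` — `fieldShift` is measure-preserving
(lit `T3LevelShift.measurePreserving_fieldShift`) and print's window is `fieldShift`-invariant (lit `T3CruxEstimates.plaqSmall_fieldShift`). [cite: Balaban1985UV3, (4) p.256] -/
theorem measureReal_window_level_eq (hK : n ≤ K) (δ : ℝ) :
    (fieldMeasure (F.P K) (K - n) (Matrix.specialUnitaryGroup (Fin 2) ℂ)).real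
        {W : GaugeField (F.P K) (K - n) (Matrix.specialUnitaryGroup (Fin 2) ℂ) | PlaqSmall δ W} =
      (fieldMeasure (F.P n) 0 (Matrix.specialUnitaryGroup (Fin 2) ℂ)).real
        {V : GaugeField (F.P n) 0 (Matrix.specialUnitaryGroup (Fin 2) ℂ) | PlaqSmall δ V} := by
  have hsd : (F.PP F.m K).sitesPerDir (K - n) = (F.PP F.m n).sitesPerDir 0 :=
    F.sitesPerDir_eq (m := F.m) (K := K) (j := K - n) (m' := F.m) (K' := n) (j' := 0) (by omega)
  have hmp := measurePreserving_fieldShift (G := Matrix.specialUnitaryGroup (Fin 2) ℂ) (F := F) hsd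
  have h2 : (fieldShift (G := Matrix.specialUnitaryGroup (Fin 2) ℂ) hsd) ⁻¹'
        {W : GaugeField (F.P K) (K - n) (Matrix.specialUnitaryGroup (Fin 2) ℂ) | PlaqSmall δ W} =
      {V : GaugeField (F.P n) 0 (Matrix.specialUnitaryGroup (Fin 2) ℂ) | PlaqSmall δ V} := by
    ext V
    exact T3CruxEstimates.plaqSmall_fieldShift F hsd δ V
  have h1 : (fieldMeasure (F.P n) 0 (Matrix.specialUnitaryGroup (Fin 2) ℂ))
        ((fieldShift (G := Matrix.specialUnitaryGroup (Fin 2) ℂ) hsd) ⁻¹'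
          {W : GaugeField (F.P K) (K - n) (Matrix.specialUnitaryGroup (Fin 2) ℂ) | PlaqSmall δ W}) =
      (fieldMeasure (F.P K) (K - n) (Matrix.specialUnitaryGroup (Fin 2) ℂ))
        {W : GaugeField (F.P K) (K - n) (Matrix.specialUnitaryGroup (Fin 2) ℂ) | PlaqSmall δ W} :=
    hmp.measure_preimage
      (measurableSet_plaqSmall (G := Matrix.specialUnitaryGroup (Fin 2) ℂ) (P := F.P K) (j := K - n) δ).nullMeasurableSet
  have h3 : (fieldMeasure (F.P n) 0 (Matrix.specialUnitaryGroup (Fin 2) ℂ))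
        {V : GaugeField (F.P n) 0 (Matrix.specialUnitaryGroup (Fin 2) ℂ) | PlaqSmall δ V} =
      (fieldMeasure (F.P K) (K - n) (Matrix.specialUnitaryGroup (Fin 2) ℂ))
        {W : GaugeField (F.P K) (K - n) (Matrix.specialUnitaryGroup (Fin 2) ℂ) | PlaqSmall δ W} := h2 ▸ h1
  simp only [Measure.real, h3]

variable {F}
variable {𝔠 : AlphaConsts F.L (suGroupModel 2).N} {γ : ℝ} {hγ : 0 < γ} {hγ1 : γ ≤ (min 𝔠.gamma0 1) ^ 2}
  (p : AlphaInputsT3AC.PkgAtV3 F 𝔠 γ hγ hγ1 K)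

/-- `0 < θBal(n)` on the coupling window (lit `T3MinimiserStabilityReduction.θBal_pos`; `b₀ > 0` by the record). [cite: Balaban1985UV3, (7) p.257] -/
theorem θBal_pos_of_window (𝔠 : AlphaConsts F.L (suGroupModel 2).N) {γ : ℝ} (hγ : 0 < γ) (hγ1 : γ ≤ (min 𝔠.gamma0 1) ^ 2) (n : ℕ) :
    0 < θBal F.L γ 𝔠.b₀ 𝔠.p₀ n :=
  T3MinimiserStabilityReduction.θBal_pos F.hL.2.le hγ (hγ1.trans (sq_min_one_le _ 𝔠.gamma0_pos)) 𝔠.b₀_pos 𝔠.p₀ n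

/-- ★★★ **THE TWO-SIDED QUOTIENT BOUNDS AT LEVEL `K − n` FROM THE TWO HALVES — THE ANCHOR `exp(−(E_{K−n} − E))` CANCELS.**  Given, at level `j = K − n` of the v3 record's
tower: the (46) bound `|Pint_j| ≤ CP` (every history), `exp(Rm_j) ≤ CRu`, the (41) large-field history-sum bound `B` a.e. (px8's `lfSum_le_exp_ae_of_massEnvelope`∕`exists_lfSum_le_exp_ae`), and the main-term row
`mainT_j(triv, W) ≤ M` on print's window `{PlaqSmall θBal(n)}`: a.e. `Z_K⁻¹·ρ^{univ}_j ≤ (CRu·e^{CP}·B) ∕ (CRu⁻¹·e^{−M−CP}·vol_n)` and, a.e. on the window,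
`(CRu⁻¹·e^{−M−CP}) ∕ (CRu·e^{CP}·B) ≤ Z_K⁻¹·ρ^{univ}_j` — MASS PRESERVATION `∫ρ_j dV_j = Z_K` (✓`integral_emlDensity_eq_partitionFn` at level `j`) and §1; `vol_n` = the
height-`n` window volume (`measureReal_window_level_eq`).  No counterterm size (62)–(65) enters. [cite: Balaban1985UV3, (5)–(6) pp.256–257, (41) p.266, (46)–(47) p.267] -/
theorem ae_quotient_bounds_level (hK : n ≤ K) {CP CRu B M : ℝ} (hCRu : 0 < CRu) (hB : 0 < B)
    (hP : ∀ (r : Hist (F.P K) (K - n)) (W : GaugeField (F.P K) (K - n) (Matrix.specialUnitaryGroup (Fin 2) ℂ)), |p.T.Pint (K - n) r W| ≤ CP)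
    (hRm : Real.exp (p.T.Rm (K - n)) ≤ CRu)
    (hBae : ∀ᵐ W ∂fieldMeasure (F.P K) (K - n) (Matrix.specialUnitaryGroup (Fin 2) ℂ),
      ∑ r : Hist (F.P K) (K - n), p.wtP (K - n) r W * Real.exp (-(p.T.mainT (K - n) r W) + p.T.Zterm (K - n) r) ≤ B)
    (hM : ∀ (W : GaugeField (F.P K) (K - n) (Matrix.specialUnitaryGroup (Fin 2) ℂ)), PlaqSmall (θBal F.L γ 𝔠.b₀ 𝔠.p₀ n) W →
      p.T.mainT (K - n) (p.T.triv (K - n)) W ≤ M) :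
    (∀ᵐ W ∂fieldMeasure (F.P K) (K - n) (Matrix.specialUnitaryGroup (Fin 2) ℂ),
      (partitionFn (G := Matrix.specialUnitaryGroup (Fin 2) ℂ) (F.P K) ((F.scheme ℰp γ).β K))⁻¹ * resDensity F γ K Set.univ (K - n) W ≤
        (CRu * Real.exp CP * B) / ((CRu⁻¹ * Real.exp (-M - CP)) *
          (fieldMeasure (F.P n) 0 (Matrix.specialUnitaryGroup (Fin 2) ℂ)).real
            {V : GaugeField (F.P n) 0 (Matrix.specialUnitaryGroup (Fin 2) ℂ) | PlaqSmall (θBal F.L γ 𝔠.b₀ 𝔠.p₀ n) V})) ∧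
    (∀ᵐ W ∂fieldMeasure (F.P K) (K - n) (Matrix.specialUnitaryGroup (Fin 2) ℂ), PlaqSmall (θBal F.L γ 𝔠.b₀ 𝔠.p₀ n) W →
      (CRu⁻¹ * Real.exp (-M - CP)) / (CRu * Real.exp CP * B) ≤
        (partitionFn (G := Matrix.specialUnitaryGroup (Fin 2) ℂ) (F.P K) ((F.scheme ℰp γ).β K))⁻¹ * resDensity F γ K Set.univ (K - n) W) := by
  haveI := isProbabilityMeasure_fieldMeasure (G := Matrix.specialUnitaryGroup (Fin 2) ℂ) (F.P K) (K - n)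
  have hKn : K - (K - n) = n := by omega
  -- the two halves at level `K − n`
  have hup := ae_resDensity_le_anchor p (K - n) (Nat.sub_le K n) (CP := CP) (fun r W => (abs_le.mp (hP r W)).2) hRm hBae
  have hlow := ae_anchor_le_resDensity p (K - n) (Nat.sub_le K n) (CP := CP) (M := M)
    (fun W => (abs_le.mp (hP (p.T.triv (K - n)) W)).1) hRm (by rw [hKn]; exact hM)
  rw [hKn] at hlow
  -- integrability, nonnegativity, mass preservation, window volume
  have hint : Integrable (resDensity F γ K Set.univ (K - n)) (fieldMeasure (F.P K) (K - n) (Matrix.specialUnitaryGroup (Fin 2) ℂ)) :=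
    integrable_resDensity F K MeasurableSet.univ hγ.le (by omega)
  have h0 : ∀ W, 0 ≤ resDensity F γ K Set.univ (K - n) W := resDensity_nonneg F γ K Set.univ (K - n)
  have hZ : ∫ W, resDensity F γ K Set.univ (K - n) W ∂fieldMeasure (F.P K) (K - n) (Matrix.specialUnitaryGroup (Fin 2) ℂ) =
      partitionFn (G := Matrix.specialUnitaryGroup (Fin 2) ℂ) (F.P K) ((F.scheme ℰp γ).β K) := by
    rw [UV3UnitPartitionLowerOfPackage.resDensity_univ_eq,
      UV3PinnedRatioOfTowerBounds.integral_emlDensity_eq_partitionFn F K hγ.le (K - n) (by omega)]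
  have hS := measurableSet_plaqSmall (G := Matrix.specialUnitaryGroup (Fin 2) ℂ) (P := F.P K) (j := K - n) (θBal F.L γ 𝔠.b₀ 𝔠.p₀ n)
  have hvol : 0 < (fieldMeasure (F.P K) (K - n) (Matrix.specialUnitaryGroup (Fin 2) ℂ)).real
      {W : GaugeField (F.P K) (K - n) (Matrix.specialUnitaryGroup (Fin 2) ℂ) | PlaqSmall (θBal F.L γ 𝔠.b₀ 𝔠.p₀ n) W} := by
    rw [measureReal_window_level_eq F hK]
    exact ENNReal.toReal_pos (fieldMeasure_plaqSmall_pos (P := F.P n) (j := 0) (θBal_pos_of_window 𝔠 hγ hγ1 n)).ne' (measure_ne_top _ _)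
  have he : 0 < Real.exp (-(p.T.Ecst (K - n) - p.E)) := Real.exp_pos _
  have hℓ : 0 < CRu⁻¹ * Real.exp (-M - CP) := by positivity
  have hU : 0 < CRu * Real.exp CP * B := by positivity
  refine ⟨?_, ?_⟩
  · have h := ae_inv_integral_mul_le_of_halves hint h0 hS hvol he hℓ hup hlow
    rw [hZ, measureReal_window_level_eq F hK] at h
    exact h
  · have h := ae_le_inv_integral_mul_of_halves hint h0 hS hvol he hU hℓ hup hlow
    rw [hZ] at h
    filter_upwards [h] with W hW hsmall using hW hsmall

end Height

end Summit.QuantumFields.YangMills.Theorems.FluctuationComparisonRegPrIntLHeightwiseQuotientAnchoring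

end
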